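import Mathlib.Data.Matrix.Mul
import Mathlib.LinearAlgebra.Matrix.Kronecker
import Mathlib.LinearAlgebra.Matrix.ConjTranspose
import Mathlib.Analysis.InnerProductSpace.Adjoint
import Mathlib.Algebra.BigOperators.Fin
import Literature.MathematicalPhysics.QuantumLattice.SpinSystem
import HarnessLib

/-!
# The Fendley–Yang dynamic lattice supercharge of the open spin-½ XXZ chain at `Δ = -1/2`

Topic `MathematicalPhysics/QuantumLattice`; vocabulary of `SpinSystem.lean` (decision Q-D1:
`TensorIndex (Fin L) 2 = Fin L → Fin 2` are the classical configurations of a chain of length `L`,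
`V^L = ℂ^{TensorIndex (Fin L) 2}`, `Op (Fin L) 2` the `2^L × 2^L` matrices; `0 : Fin 2` is
`|0⟩ = |↑⟩ = (1,0)ᵀ`, `1 : Fin 2` is `|1⟩ = |↓⟩ = (0,1)ᵀ`, the convention of `spinHalfPauli`).

The spin-½ XXZ chain at anisotropy `Δ = -1/2` has a *dynamic* `N = 2` lattice supersymmetry
(Fendley–Yang 2004; Hagendorf–Liénardy 2017 §2): a nilpotent LENGTH-INCREASING supercharge
`Q : V^L → V^{L+1}`. This file defines it and proves `Q² = 0`.

* `FendleyYang.localSupercharge` — the local supercharge `q : V → V ⊗ V`, `q|0⟩ = 0`,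
  `q|1⟩ = |0⟩ ⊗ |0⟩` (HL2017 §2, the `ℓ = 1` example; Yang–Fendley 2004), a `(Fin 2 × Fin 2) × Fin 2`
  matrix; `FendleyYang.localSupercharge_coassoc` is the coassociativity `(q ⊗ 1 - 1 ⊗ q) q = 0`
  (HL2017 §2; here both terms vanish separately).
* `FendleyYang.insertPair j σ` — the configuration of length `L+1` obtained from `σ` by replacing
  the spin at site `j` by the pair `↑↑`; `FendleyYang.siteSupercharge j = q_j = 1 ⊗ ⋯ ⊗ q ⊗ ⋯ ⊗ 1`
  (`q` at site `j`, HL2017 §2), given by its entries `⟨τ| q_j |σ⟩ = [σ_j = 1 ∧ τ = insertPair j σ]`;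
  `FendleyYang.siteSupercharge_apply_eq_local` shows that this IS the tensor-product formula.
* `fendleyYangSupercharge L = Q = Σ_{j=1}^{L} (-1)^j q_j : V^L → V^{L+1}` (HL2017 §2; sites
  are `j : Fin L`, so the sign reads `(-1)^(j.val + 1)`), a rectangular matrix
  `Matrix (TensorIndex (Fin (L+1)) 2) (TensorIndex (Fin L) 2) ℂ`. Its adjoint `Q† : V^{L+1} → V^L`
  for the standard scalar product is the conjugate transpose (`fendleyYangSupercharge_adjoint`).
* PROVED: `fendleyYangSupercharge_sq : Q_{L+1} Q_L = 0` (HL2017 §2) and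
  `fendleyYangSupercharge_conjTranspose_sq : (Q†)² = 0`, via the exchange relation
  `FendleyYang.siteSupercharge_castSucc_mul : q_i q_j = q_{j+1} q_i (i ≤ j)` and the sign-reversing
  involution `(i, j) ↔ (j+1, i)` on index pairs.

The Hamiltonian `H = Q Q† + Q† Q`, `H Q = Q H` and its identification with the open XXZ chain at
`Δ = -1/2` (HL2017 §2) are in `FendleyYangHamiltonian.lean`.

## Sources

* X. Yang, P. Fendley, *Non-local spacetime supersymmetry on the lattice*, J. Phys. A 37 (2004)
  8937 (the supercharge of the XXZ chain at `Δ = -1/2`). [key `YangFendley2004`]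
* C. Hagendorf, J. Liénardy, *Open spin chains with dynamic lattice supersymmetry*, J. Phys. A 50
  (2017) 185202 = arXiv:1612.02951, §2 (supercharge, coassociativity, nilpotency) and the `ℓ = 1` example.
  [key `HagendorfLienardy2017`]

## Design choices / what is not here

* Length-changing operators do not fit `Op Λ q`; we use rectangular matrices between the
  configuration types of `Fin L` and `Fin (L+1)`, so that `Q_{L+1} * Q_L` and `Q_Lᴴ * Q_L : Op (Fin L) 2`
  are ordinary matrix products and `onSite`, `spinHalfPauli` apply to `H` unchanged.
* `insertPair` is an explicit formula in `k.val` (sites `< j` unchanged, sites `j`, `j+1` equal to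
  `↑`, sites `> j+1` shifted down by one) rather than an iterated `Fin.insertNth`; the exchange law
  `insertPair_comm` is then decided by `omega`.
* Only the spin-½ (`ℓ = 1`) local supercharge of Fendley–Yang is formalised, not the higher-spin
  supercharges of HL2017 §2 (arbitrary `ℓ`) or the boundary deformations `Q(y)` of HL2017 §3.
-/

noncomputable section

open Matrix Complex Finset
open scoped Kronecker

namespace Literature.MathematicalPhysics.QuantumLattice

namespace FendleyYang

/-! ### The local supercharge -/

/-- The **Fendley–Yang local supercharge** `q : V → V ⊗ V` of the spin-½ XXZ chain at `Δ = -1/2`,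
`q|0⟩ = 0`, `q|1⟩ = |0⟩ ⊗ |0⟩` (`|0⟩ = ↑`, `|1⟩ = ↓`), as the matrix with rows indexed by the
product basis `|a⟩ ⊗ |b⟩ ↔ (a, b)` of `V ⊗ V` and columns by the basis of `V`: the only non-zero
entry is `⟨00| q |1⟩ = 1`. Hagendorf–Liénardy (2017) §2, the displayed equation for `ℓ = 1`
("found by Fendley and Yang"); Yang–Fendley (2004) §2. [cite: HagendorfLienardy2017, §2] -/
def localSupercharge : Matrix (Fin 2 × Fin 2) (Fin 2) ℂ :=
  of fun ab m => if m = 1 ∧ ab = (0, 0) then 1 else 0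

/-- Entries of the local supercharge (definitional unfolding). [cite: HagendorfLienardy2017, §2] -/
theorem localSupercharge_apply (ab : Fin 2 × Fin 2) (m : Fin 2) :
    localSupercharge ab m = if m = 1 ∧ ab = (0, 0) then 1 else 0 := rfl

/-- `q|0⟩ = 0`: the column of `|0⟩ = |↑⟩` vanishes. [cite: HagendorfLienardy2017, §2] -/
@[simp] theorem localSupercharge_apply_zero (ab : Fin 2 × Fin 2) : localSupercharge ab 0 = 0 := by
  simp [localSupercharge_apply]

/-- `q|1⟩ = |00⟩`: the column of `|1⟩ = |↓⟩` is the basis vector `|0⟩ ⊗ |0⟩`.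
[cite: HagendorfLienardy2017, §2] -/
@[simp] theorem localSupercharge_apply_one (ab : Fin 2 × Fin 2) :
    localSupercharge ab 1 = if ab = (0, 0) then 1 else 0 := by
  simp [localSupercharge_apply]

/-- `(q ⊗ 1) q = 0`: splitting `|1⟩ ↦ |00⟩` and then splitting the first factor gives zero, since
`q|0⟩ = 0`. [cite: HagendorfLienardy2017, §2 (coassociativity)] -/
theorem kronecker_one_mul_localSupercharge :
    localSupercharge ⊗ₖ (1 : Matrix (Fin 2) (Fin 2) ℂ) * localSupercharge = 0 := by
  ext ⟨⟨a, b⟩, c⟩ m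
  simp [Matrix.mul_apply, Fintype.sum_prod_type, localSupercharge_apply, Matrix.one_apply]

/-- `(1 ⊗ q) q = 0` (rows re-bracketed to `(V ⊗ V) ⊗ V`): splitting `|1⟩ ↦ |00⟩` and then the
second factor gives zero. [cite: HagendorfLienardy2017, §2 (coassociativity)] -/
theorem one_kronecker_mul_localSupercharge :
    reindex (Equiv.prodAssoc (Fin 2) (Fin 2) (Fin 2)).symm (Equiv.refl _)
        ((1 : Matrix (Fin 2) (Fin 2) ℂ) ⊗ₖ localSupercharge) * localSupercharge = 0 := by
  ext ⟨⟨a, b⟩, c⟩ m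
  simp [Matrix.mul_apply, Fintype.sum_prod_type, localSupercharge_apply, Matrix.one_apply]

/-- **Coassociativity** `(q ⊗ 1 - 1 ⊗ q) q = 0` of the Fendley–Yang local supercharge (as maps
`V → V ⊗ V ⊗ V`, rows indexed by `(V ⊗ V) ⊗ V`), the local identity behind `Q² = 0`.
Hagendorf–Liénardy (2017) §2 (coassociativity property). [cite: HagendorfLienardy2017, §2 (coassociativity)] -/
theorem localSupercharge_coassoc :
    (localSupercharge ⊗ₖ (1 : Matrix (Fin 2) (Fin 2) ℂ) -
        reindex (Equiv.prodAssoc (Fin 2) (Fin 2) (Fin 2)).symm (Equiv.refl _)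
          ((1 : Matrix (Fin 2) (Fin 2) ℂ) ⊗ₖ localSupercharge)) * localSupercharge = 0 := by
  rw [Matrix.sub_mul, kronecker_one_mul_localSupercharge, one_kronecker_mul_localSupercharge,
    sub_zero]

/-! ### Inserting a pair `↑↑` in place of one site -/

variable {L : ℕ}

/-- `insertPair j σ`: the configuration of the chain of length `L + 1` obtained from
`σ : Fin L → Fin 2` by replacing the spin at site `j` by the pair `↑↑ = 00` — sites `k < j` keep
`σ_k`, sites `j`, `j+1` carry `0`, sites `k > j+1` carry `σ_{k-1}`. This is the support of
`q_j |σ⟩` when `σ_j = 1`. [cite: HagendorfLienardy2017, §2 (def. of q_j)] -/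
def insertPair (j : Fin L) (σ : TensorIndex (Fin L) 2) : TensorIndex (Fin (L + 1)) 2 := fun k =>
  if hk : k.val < j.val then σ ⟨k.val, by omega⟩
  else if hk' : k.val ≤ j.val + 1 then 0
  else σ ⟨k.val - 1, by omega⟩

/-- Value of `insertPair j σ` at a site, as a formula in the site's index.
[cite: HagendorfLienardy2017, §2 (def. of q_j)] -/
theorem insertPair_apply (j : Fin L) (σ : TensorIndex (Fin L) 2) (k : Fin (L + 1)) :
    insertPair j σ k =
      if hk : k.val < j.val then σ ⟨k.val, by omega⟩
      else if hk' : k.val ≤ j.val + 1 then 0 else σ ⟨k.val - 1, by omega⟩ := rfl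

/-- Sites left of `j` are unchanged: `(insertPair j σ) i = σ i` for `i < j`. [folklore] -/
@[simp] theorem insertPair_apply_castSucc_of_lt {i j : Fin L} (h : i < j) (σ : TensorIndex (Fin L) 2) :
    insertPair j σ i.castSucc = σ i := by
  have h' : i.val < j.val := h
  simp only [insertPair_apply, Fin.val_castSucc, dif_pos h', Fin.eta]

/-- The first inserted spin is `↑`: `(insertPair j σ) j = 0`. [folklore] -/
@[simp] theorem insertPair_apply_castSucc_self (j : Fin L) (σ : TensorIndex (Fin L) 2) :
    insertPair j σ j.castSucc = 0 := by
  simp [insertPair_apply]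

/-- The second inserted spin is `↑`: `(insertPair j σ) (j+1) = 0`. [folklore] -/
@[simp] theorem insertPair_apply_succ_self (j : Fin L) (σ : TensorIndex (Fin L) 2) :
    insertPair j σ j.succ = 0 := by
  simp [insertPair_apply]

/-- Sites right of `j` are shifted by one: `(insertPair j σ) (i+1) = σ i` for `j < i`. [folklore] -/
@[simp] theorem insertPair_apply_succ_of_lt {i j : Fin L} (h : j < i) (σ : TensorIndex (Fin L) 2) :
    insertPair j σ i.succ = σ i := by
  have h' : j.val < i.val := h
  have h1 : ¬ (i.succ : Fin (L + 1)).val < j.val := by simp; omega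
  have h2 : ¬ (i.succ : Fin (L + 1)).val ≤ j.val + 1 := by simp; omega
  simp only [insertPair_apply, h1, h2, dite_false]
  congr 1

/-- **Exchange of insertions.** For `i < j`, inserting at `j` and then at `i` gives the same
configuration as inserting at `i` and then at the shifted site `j + 1`. [folklore] -/
theorem insertPair_comm {i j : Fin L} (h : i < j) (σ : TensorIndex (Fin L) 2) :
    insertPair i.castSucc (insertPair j σ) = insertPair j.succ (insertPair i σ) := by
  have h' : i.val < j.val := h
  funext k
  simp only [insertPair_apply, Fin.val_castSucc, Fin.val_succ]
  split_ifs <;> first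
    | rfl
    | (exfalso; omega)

/-- Characterisation of `insertPair j σ` by its values: `σ` on the sites left of `j`, `↑↑` at
`j, j+1`, and `σ` shifted by one on the sites right of `j`. [folklore] -/
theorem eq_insertPair_iff (j : Fin L) (σ : TensorIndex (Fin L) 2) (τ : TensorIndex (Fin (L + 1)) 2) :
    τ = insertPair j σ ↔ (∀ i : Fin L, i < j → τ i.castSucc = σ i) ∧ τ j.castSucc = 0 ∧
      τ j.succ = 0 ∧ (∀ i : Fin L, j < i → τ i.succ = σ i) := by
  constructor
  · rintro rfl
    exact ⟨fun i hi => insertPair_apply_castSucc_of_lt hi σ, insertPair_apply_castSucc_self j σ,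
      insertPair_apply_succ_self j σ, fun i hi => insertPair_apply_succ_of_lt hi σ⟩
  · rintro ⟨h1, h2, h3, h4⟩
    funext k
    rcases lt_trichotomy k.val j.val with hk | hk | hk
    · set i : Fin L := ⟨k.val, by omega⟩
      have hk' : k = i.castSucc := Fin.ext rfl
      have hij : i < j := hk
      rw [hk', h1 i hij, insertPair_apply_castSucc_of_lt hij]
    · have hk' : k = j.castSucc := Fin.ext hk
      rw [hk', h2, insertPair_apply_castSucc_self]
    · rcases Nat.lt_or_ge (j.val + 1) k.val with hk2 | hk2
      · set i : Fin L := ⟨k.val - 1, by omega⟩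
        have hk' : k = i.succ := Fin.ext (by simp [i]; omega)
        have hij : j < i := by change j.val < k.val - 1; omega
        rw [hk', h4 i hij, insertPair_apply_succ_of_lt hij]
      · have hk' : k = j.succ := Fin.ext (by simp; omega)
        rw [hk', h3, insertPair_apply_succ_self]

/-- `insertPair j` is injective on configurations with `σ_j = 1` — indeed on all of them once the
value at `j` is fixed: the other sites can be read off. [folklore] -/
theorem insertPair_injective_of_eq {j : Fin L} {σ σ' : TensorIndex (Fin L) 2} (hj : σ j = σ' j)
    (h : insertPair j σ = insertPair j σ') : σ = σ' := by
  funext i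
  rcases lt_trichotomy i j with hij | rfl | hij
  · rw [← insertPair_apply_castSucc_of_lt hij σ, ← insertPair_apply_castSucc_of_lt hij σ', h]
  · exact hj
  · rw [← insertPair_apply_succ_of_lt hij σ, ← insertPair_apply_succ_of_lt hij σ', h]

/-! ### The site supercharges `q_j` -/

/-- The **site supercharge** `q_j = 1 ⊗ ⋯ ⊗ 1 ⊗ q ⊗ 1 ⊗ ⋯ ⊗ 1 : V^L → V^{L+1}` (`q` acting on
site `j`), as the rectangular matrix with entries `⟨τ| q_j |σ⟩ = 1` if `σ_j = 1 = ↓` and `τ` is `σ`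
with site `j` replaced by `↑↑`, and `0` otherwise. Hagendorf–Liénardy (2017) §2 (definition of q_j);
see `siteSupercharge_apply_eq_local` for the tensor-product form. [cite: HagendorfLienardy2017, §2 (def. of q_j)] -/
def siteSupercharge (j : Fin L) :
    Matrix (TensorIndex (Fin (L + 1)) 2) (TensorIndex (Fin L) 2) ℂ :=
  of fun τ σ => if σ j = 1 ∧ τ = insertPair j σ then 1 else 0

/-- Entries of `q_j` (definitional unfolding). [cite: HagendorfLienardy2017, §2 (def. of q_j)] -/
theorem siteSupercharge_apply (j : Fin L) (τ : TensorIndex (Fin (L + 1)) 2)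
    (σ : TensorIndex (Fin L) 2) :
    siteSupercharge j τ σ = if σ j = 1 ∧ τ = insertPair j σ then 1 else 0 := rfl

/-- **`q_j` is `1 ⊗ ⋯ ⊗ q ⊗ ⋯ ⊗ 1`.** The entry `⟨τ| q_j |σ⟩` vanishes unless `τ` agrees with `σ`
on the sites left of `j` and, shifted by one, on the sites right of `j`; in that case it is the
entry `⟨τ_j τ_{j+1}| q |σ_j⟩` of the local supercharge. Hagendorf–Liénardy (2017) §2 (definition of q_j).
[cite: HagendorfLienardy2017, §2 (def. of q_j)] -/
theorem siteSupercharge_apply_eq_local (j : Fin L) (τ : TensorIndex (Fin (L + 1)) 2)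
    (σ : TensorIndex (Fin L) 2) :
    siteSupercharge j τ σ =
      if (∀ i : Fin L, i < j → τ i.castSucc = σ i) ∧ (∀ i : Fin L, j < i → τ i.succ = σ i) then
        localSupercharge (τ j.castSucc, τ j.succ) (σ j) else 0 := by
  rw [siteSupercharge_apply, localSupercharge_apply]
  by_cases h : σ j = 1 ∧ τ = insertPair j σ
  · obtain ⟨hσ, hτ⟩ := h
    have h' := (eq_insertPair_iff j σ τ).1 hτ
    rw [if_pos ⟨hσ, hτ⟩, if_pos ⟨h'.1, h'.2.2.2⟩, if_pos ⟨hσ, by rw [h'.2.1, h'.2.2.1]⟩]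
  · rw [if_neg h]
    split_ifs with h1 h2
    · exact absurd ⟨h2.1, (eq_insertPair_iff j σ τ).2
        ⟨h1.1, (Prod.mk.inj h2.2).1, (Prod.mk.inj h2.2).2, h1.2⟩⟩ h
    · rfl
    · rfl

/-- Entries of a product `q_a q_b : V^L → V^{L+2}` of two site supercharges: the intermediate sum
collapses to the single configuration `insertPair b σ`. [folklore] -/
theorem siteSupercharge_mul_apply (a : Fin (L + 1)) (b : Fin L)
    (υ : TensorIndex (Fin (L + 2)) 2) (σ : TensorIndex (Fin L) 2) :
    (siteSupercharge a * siteSupercharge b) υ σ =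
      if σ b = 1 ∧ insertPair b σ a = 1 ∧ υ = insertPair a (insertPair b σ) then 1 else 0 := by
  rw [Matrix.mul_apply]
  by_cases hb : σ b = 1
  · have key : ∀ τ : TensorIndex (Fin (L + 1)) 2,
        siteSupercharge a υ τ * siteSupercharge b τ σ =
          if τ = insertPair b σ then siteSupercharge a υ τ else 0 := by
      intro τ
      rw [siteSupercharge_apply b]
      split_ifs with h1 h2 h2
      · rw [mul_one]
      · exact absurd h1.2 h2
      · exact absurd ⟨hb, h2⟩ h1
      · rw [mul_zero]
    simp_rw [key, Finset.sum_ite_eq' Finset.univ, Finset.mem_univ, if_true, siteSupercharge_apply,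
      hb, true_and]
  · have key : ∀ τ : TensorIndex (Fin (L + 1)) 2,
        siteSupercharge a υ τ * siteSupercharge b τ σ = 0 := by
      intro τ
      rw [siteSupercharge_apply b, if_neg (fun h => hb h.1), mul_zero]
    simp [key, hb]

/-- **Exchange relation** `q_i q_j = q_{j+1} q_i` for `i ≤ j` (as maps `V^L → V^{L+2}`; on the
left `q_i` acts on `V^{L+1}` at the unshifted site `i`, on the right `q_{j+1}` at the shifted
site). For `i < j` the two insertions are disjoint; for `i = j` both sides vanish, which is the
coassociativity `(q ⊗ 1) q = (1 ⊗ q) q (= 0)` of the local supercharge placed at site `j`.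
Hagendorf–Liénardy (2017) §2 (the step from coassociativity to `Q² = 0`). [cite: HagendorfLienardy2017, §2] -/
theorem siteSupercharge_castSucc_mul {i j : Fin L} (hij : i ≤ j) :
    siteSupercharge i.castSucc * siteSupercharge j =
      siteSupercharge j.succ * siteSupercharge (L := L) i := by
  ext υ σ
  rw [siteSupercharge_mul_apply, siteSupercharge_mul_apply]
  rcases hij.lt_or_eq with h | rfl
  · rw [insertPair_apply_castSucc_of_lt h, insertPair_apply_succ_of_lt h, insertPair_comm h]
    by_cases hi : σ i = 1 <;> by_cases hj : σ j = 1 <;> simp [hi, hj]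
  · simp

/-! ### The supercharge `Q` -/

/-- The **Fendley–Yang supercharge** `Q = Σ_{j=1}^{L} (-1)^j q_j : V^L → V^{L+1}` of the open
spin-½ XXZ chain at `Δ = -1/2` (sites are `j : Fin L`, so the sign of the 1-indexed formula is
`(-1)^(j.val + 1)`), a rectangular `2^{L+1} × 2^L` matrix. On a basis state,
`Q|σ⟩ = Σ_{j : σ_j = ↓} (-1)^{j+1} |σ with ↓_j replaced by ↑↑⟩`. Its adjoint `Q† : V^{L+1} → V^L` for
the standard scalar product is the conjugate transpose `(fendleyYangSupercharge L)ᴴ`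
(`fendleyYangSupercharge_adjoint`). Hagendorf–Liénardy (2017) §2 (definitions of Q and q_j);
Yang–Fendley (2004). [cite: HagendorfLienardy2017, §2 (def. of Q)] -/
def _root_.Literature.MathematicalPhysics.QuantumLattice.fendleyYangSupercharge (L : ℕ) :
    Matrix (TensorIndex (Fin (L + 1)) 2) (TensorIndex (Fin L) 2) ℂ :=
  ∑ j : Fin L, (-1 : ℂ) ^ (j.val + 1) • siteSupercharge j

/-- Unfolding of `Q` as the alternating sum of site supercharges. [cite: HagendorfLienardy2017, §2 (def. of Q)] -/
theorem supercharge_def (L : ℕ) :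
    fendleyYangSupercharge L = ∑ j : Fin L, (-1 : ℂ) ^ (j.val + 1) • siteSupercharge j := rfl

/-- Entries of `Q`: `⟨τ| Q |σ⟩ = Σ_j (-1)^{j+1} [σ_j = 1 ∧ τ = insertPair j σ]`.
[cite: HagendorfLienardy2017, §2 (def. of Q, q_j)] -/
theorem supercharge_apply (L : ℕ) (τ : TensorIndex (Fin (L + 1)) 2) (σ : TensorIndex (Fin L) 2) :
    fendleyYangSupercharge L τ σ =
      ∑ j : Fin L, if σ j = 1 ∧ τ = insertPair j σ then (-1 : ℂ) ^ (j.val + 1) else 0 := by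
  simp only [supercharge_def, Matrix.sum_apply, Matrix.smul_apply, siteSupercharge_apply,
    smul_eq_mul, mul_ite, mul_one, mul_zero]

/-- On the empty chain `V^0 = ℂ` the supercharge is the empty sum: `Q = 0 : V^0 → V^1`. [folklore] -/
@[simp] theorem supercharge_zero : fendleyYangSupercharge 0 = 0 := by
  simp [supercharge_def]

/-- **Action on basis states.** `Q|σ⟩ = Σ_{j} (-1)^{j+1} [σ_j = ↓] |insertPair j σ⟩`, with
`|σ⟩ = Pi.single σ 1` the product basis vector. [cite: HagendorfLienardy2017, §2 (def. of Q, q_j)] -/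
theorem supercharge_mulVec_single (L : ℕ) (σ : TensorIndex (Fin L) 2) :
    fendleyYangSupercharge L *ᵥ Pi.single σ 1 =
      ∑ j : Fin L, if σ j = 1 then
        (-1 : ℂ) ^ (j.val + 1) • (Pi.single (insertPair j σ) 1 : TensorIndex (Fin (L + 1)) 2 → ℂ)
        else 0 := by
  funext τ
  rw [Matrix.mulVec_single_one, Finset.sum_apply]
  simp only [Matrix.col_apply, supercharge_apply]
  refine Finset.sum_congr rfl fun j _ => ?_
  by_cases hj : σ j = 1
  · simp only [hj, true_and, if_true, Pi.smul_apply, Pi.single_apply, smul_eq_mul, mul_ite,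
      mul_one, mul_zero]
  · simp [hj]

/-! ### Nilpotency `Q² = 0` -/

/-- The sign-reversing involution on index pairs used for `Q² = 0`: `(i, j) ↦ (j+1, i)` on
`i ≤ j` and its inverse on `i > j`. [folklore] -/
private def sqInvol (L : ℕ) (p : Fin (L + 1) × Fin L) : Fin (L + 1) × Fin L :=
  if h : p.1.val ≤ p.2.val then (p.2.succ, p.1.castLT (lt_of_le_of_lt h p.2.isLt))
  else (p.2.castSucc, p.1.pred (fun h0 => h (by simp [h0])))

/-- First component of `sqInvol`. [folklore] -/
private theorem sqInvol_fst_val {L : ℕ} (p : Fin (L + 1) × Fin L) :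
    ((sqInvol L p).1 : ℕ) = if p.1.val ≤ p.2.val then p.2.val + 1 else p.2.val := by
  unfold sqInvol
  split_ifs with h <;> simp

/-- Second component of `sqInvol`. [folklore] -/
private theorem sqInvol_snd_val {L : ℕ} (p : Fin (L + 1) × Fin L) :
    ((sqInvol L p).2 : ℕ) = if p.1.val ≤ p.2.val then p.1.val else p.1.val - 1 := by
  unfold sqInvol
  split_ifs with h <;> simp

/-- `sqInvol` is an involution. [folklore] -/
private theorem sqInvol_sqInvol {L : ℕ} (p : Fin (L + 1) × Fin L) :
    sqInvol L (sqInvol L p) = p := by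
  have h1 := sqInvol_fst_val (sqInvol L p)
  have h2 := sqInvol_snd_val (sqInvol L p)
  simp only [sqInvol_fst_val p, sqInvol_snd_val p] at h1 h2
  have hi := p.1.isLt
  have hj := p.2.isLt
  refine Prod.ext (Fin.ext ?_) (Fin.ext ?_)
  · rw [h1]
    split_ifs <;> omega
  · rw [h2]
    split_ifs <;> omega

/-- `sqInvol` has no fixed points. [folklore] -/
private theorem sqInvol_ne {L : ℕ} (p : Fin (L + 1) × Fin L) : sqInvol L p ≠ p := by
  intro h
  have h1 := sqInvol_fst_val p
  rw [h] at h1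
  split_ifs at h1 <;> omega

/-- The summand `(-1)^{i+j} q_i q_j` of `Q_{L+1} Q_L` indexed by a pair of sites. [folklore] -/
private def sqTerm (L : ℕ) (p : Fin (L + 1) × Fin L) :
    Matrix (TensorIndex (Fin (L + 2)) 2) (TensorIndex (Fin L) 2) ℂ :=
  ((-1 : ℂ) ^ (p.1.val + 1) * (-1) ^ (p.2.val + 1)) • (siteSupercharge p.1 * siteSupercharge p.2)

/-- Paired summands cancel: `(-1)^{i+j} q_i q_j + (-1)^{i+j+1} q_{j+1} q_i = 0` for `i ≤ j`.
[cite: HagendorfLienardy2017, §2 (Q² = 0)] -/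
private theorem sqTerm_add_of_le {L : ℕ} (p : Fin (L + 1) × Fin L) (h : p.1.val ≤ p.2.val) :
    sqTerm L p + sqTerm L (sqInvol L p) = 0 := by
  obtain ⟨i, j⟩ := p
  have hlt : i.val < L := lt_of_le_of_lt h j.isLt
  have hle : i.castLT hlt ≤ j := h
  have hsq : sqInvol L (i, j) = (j.succ, i.castLT hlt) := by
    unfold sqInvol
    rw [dif_pos h]
  have hi : i = (i.castLT hlt).castSucc := Fin.ext rfl
  rw [hsq]
  simp only [sqTerm]
  rw [congrArg siteSupercharge hi, siteSupercharge_castSucc_mul hle, ← add_smul]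
  have : (-1 : ℂ) ^ (i.val + 1) * (-1) ^ (j.val + 1) +
      (-1) ^ ((j.succ : Fin (L + 1)).val + 1) * (-1) ^ ((i.castLT hlt).val + 1) = 0 := by
    simp only [Fin.val_succ, Fin.val_castLT]
    ring
  rw [this, zero_smul]

/-- **Nilpotency `Q² = 0`**: the composite `V^L → V^{L+1} → V^{L+2}` of two supercharges vanishes,
for every `L`. Proof as in Hagendorf–Liénardy (2017) §2: by the exchange relation
`q_i q_j = q_{j+1} q_i` (`i ≤ j`, which at `i = j` is the coassociativity of `q`) the terms of
`Σ_{i,j} (-1)^{i+j} q_i q_j` cancel in pairs `(i, j) ↔ (j+1, i)`.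
[cite: HagendorfLienardy2017, §2 (Q² = 0)] -/
theorem _root_.Literature.MathematicalPhysics.QuantumLattice.fendleyYangSupercharge_sq (L : ℕ) :
    fendleyYangSupercharge (L + 1) * fendleyYangSupercharge L = 0 := by
  have expand : fendleyYangSupercharge (L + 1) * fendleyYangSupercharge L =
      ∑ p : Fin (L + 1) × Fin L, sqTerm L p := by
    rw [supercharge_def, supercharge_def, Matrix.sum_mul, Fintype.sum_prod_type]
    refine Finset.sum_congr rfl fun i _ => ?_
    rw [Matrix.mul_sum]
    refine Finset.sum_congr rfl fun j _ => ?_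
    rw [Matrix.smul_mul, Matrix.mul_smul, smul_smul, sqTerm]
  rw [expand]
  refine Finset.sum_ninvolution (sqInvol L) (fun p => ?_) (fun p _ => sqInvol_ne p)
    (fun p => Finset.mem_univ _) sqInvol_sqInvol
  by_cases h : p.1.val ≤ p.2.val
  · exact sqTerm_add_of_le p h
  · have h' := sqTerm_add_of_le (sqInvol L p) (by
      rw [sqInvol_fst_val, sqInvol_snd_val, if_neg h, if_neg h]
      omega)
    rw [sqInvol_sqInvol] at h'
    exact (add_comm _ _).trans h'

/-- **`(Q†)² = 0`**: the adjoint supercharge is nilpotent as well, `V^{L+2} → V^{L+1} → V^L`.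
[cite: HagendorfLienardy2017, §2 ((Q†)² = 0)] -/
theorem _root_.Literature.MathematicalPhysics.QuantumLattice.fendleyYangSupercharge_conjTranspose_sq
    (L : ℕ) : (fendleyYangSupercharge L)ᴴ * (fendleyYangSupercharge (L + 1))ᴴ = 0 := by
  rw [← Matrix.conjTranspose_mul, fendleyYangSupercharge_sq, Matrix.conjTranspose_zero]

/-- **`Q†` is the adjoint of `Q`.** Under the identification of `V^L` with the Euclidean space
`ℓ²(TensorIndex (Fin L) 2)`, the conjugate-transpose matrix acts as the Hilbert-space adjoint:
`⟨ψ, Q† φ⟩ = ⟨Q ψ, φ⟩`. Hagendorf–Liénardy (2017) §2 (definition of `Q†`). [folklore] -/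
theorem _root_.Literature.MathematicalPhysics.QuantumLattice.fendleyYangSupercharge_adjoint (L : ℕ) :
    Matrix.toEuclideanLin (fendleyYangSupercharge L)ᴴ =
      LinearMap.adjoint (Matrix.toEuclideanLin (fendleyYangSupercharge L)) :=
  Matrix.toEuclideanLin_conjTranspose_eq_adjoint _

end FendleyYang

end Literature.MathematicalPhysics.QuantumLattice
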